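import Literature.Computability.AlgebraicComplexity.BI17TensorDegreeMonoidDivisibilityProofs
import Literature.Computability.AlgebraicComplexity.TensorOrbitSeparation
import Literature.Computability.AlgebraicComplexity.BI17PolystableTensorPeriodProofs
import Mathlib.Algebra.Polynomial.Roots
import Mathlib.RingTheory.RootsOfUnity.Complex
import Mathlib.GroupTheory.SpecificGroups.Cyclic
import HarnessLib

/-!
# BI 2017, §6.1–§6.2 for tensors: Reynolds-free lemmas towards Thm. 5.3 (`E(w)` generates `m a(w) ℤ`)

P. Bürgisser, C. Ikenmeyer, *Fundamental invariants of orbit closures*, J. Algebra **477** (2017)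
390–434 = arXiv:1511.02927 [BurgisserIkenmeyer2017]: Thm. 5.3 ("The degree monoid `E(w)` generates
the group `m a(w) ℤ`", proof §6.4: "analogous to §6.2", Lemmas 6.1–6.3). The forms versions are the
tree's `IsSLInvariantCoord.homogeneousComponent`, `IsSLInvariantCoord.aeval_formCoeff_smul_eq`,
`BI2017_lem_6_3_core_holds`, `BI2017_thm_3_4_holds` (`BI17DegreeExponentMonoidProofs.lean`,
`BI17CayleyIrreducibleProofs.lean`). This theorem-only file ports the pieces that do NOT need an
`SL³`-Reynolds operator:

* `IsSL3Invariant.homogeneousComponent` — homogeneous components of `SL³`-invariants are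
  `SL³`-invariant (the action commutes with the scalars `t·w`; compare coefficients of `t`);
* `IsSL3Invariant.aeval_tensorPt_smul_eq` — Lemma 6.1 for tensors: all `SL³`-invariants agree at
  `ζ w` and `w` as soon as `ζ^d = 1` for every `d ∈ E(w)`;
* `pow_eq_one_of_smul_mem_sl3Orbit` — Lemma 6.3 (core) for tensors: if `t w ∈ SL³ · w` (`w ≠ 0` of
  finite period) then `t^{m a(w)} = 1` (`χ(stab w) = μ_{a(w)}`, the tree's
  `tensorStabChiImage_eq_rootsOfUnity`).

With an invariant-separation statement for disjoint closed `SL³`-orbits (Reynolds; the tree has the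
Nullstellensatz half `IsPolystableTensor.exists_mem_vanishingIdeal_add_eq_one_of_disjoint`) and
Hilbert's nonvanishing, these give Thm. 5.3 exactly as `BI2017_thm_3_4_holds` does for forms:
`BI2017_thm_5_3_of_hilbert_of_separation` carries out that port with the two `SL³`-Reynolds outputs
as explicit hypotheses (stated inline, not as named facts), and `BI2017_thm_5_3_of_hilbert_of_separation'`
packages it in the shape of the named fact. Likewise `BI2017_lem_5_1_3_of_invariantLift` reduces the
named fact `BI2017_lem_5_1_3` (`E(w) = m a(w) E'(w)`, `e(w) = m a(w) e'(w)`) to the third Reynolds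
output, INVARIANT LIFTING from the orbit closure ("`O(\overline{Gw})^{SL}_d ≠ 0` implies
`O(V)^{SL}_d ≠ 0`", BI L1147; the algebraic Peter–Weyl argument of Lemma 3.2 (3)): a polynomial that is
`SL³`-invariant on `Gw` is congruent modulo `I(Gw)` to an `SL³`-invariant polynomial
(`mul_mem_tensorDegreeMonoid_of_lift`: its degree-`m a e` homogeneous component then extends `φ_w^e`
invariantly, by coefficient comparison along `t ↦ t·gw`). No definitions, no named facts. Honest
framing: bookkeeping lemmas; nothing here bears on VP versus VNP.

## References

* [BurgisserIkenmeyer2017] P. Bürgisser, C. Ikenmeyer, *Fundamental invariants of orbit closures*,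
  J. Algebra 477 (2017) 390–434; arXiv:1511.02927, §6.1 Lemma 6.1, §6.2 Lemma 6.3, Thm. 5.3 / §6.4.
-/

noncomputable section

open MvPolynomial

namespace Literature.Computability.AlgebraicComplexity

section GroupLemmas

variable {ι : Type*} [Fintype ι] [DecidableEq ι]

omit [DecidableEq ι] in
/-- The action is linear in the tensor: `(A ⊗ B ⊗ C)·(c t) = c · (A ⊗ B ⊗ C)·t`. [folklore] -/
private theorem actTensor_smul_tensor₃ (A B C : Matrix ι ι ℂ) (c : ℂ) (t : ι → ι → ι → ℂ) :
    actTensor A B C (c • t) = c • actTensor A B C t := by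
  funext x y z
  simp only [actTensor_apply, Pi.smul_apply, smul_eq_mul, Finset.mul_sum]
  exact Finset.sum_congr rfl fun _ _ => Finset.sum_congr rfl fun _ _ =>
    Finset.sum_congr rfl fun _ _ => by ring

omit [DecidableEq ι] in
/-- Scalars pull out of the first slot: `((z A) ⊗ B ⊗ C)·t = z · (A ⊗ B ⊗ C)·t`. [folklore] -/
private theorem actTensor_smul_fst₃ (z : ℂ) (A B C : Matrix ι ι ℂ) (t : ι → ι → ι → ℂ) :
    actTensor (z • A) B C t = z • actTensor A B C t := by
  funext x y w
  simp only [actTensor_apply, Pi.smul_apply, Matrix.smul_apply, smul_eq_mul, Finset.mul_sum]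
  exact Finset.sum_congr rfl fun _ _ => Finset.sum_congr rfl fun _ _ =>
    Finset.sum_congr rfl fun _ _ => by ring

omit [Fintype ι] [DecidableEq ι] in
/-- Homogeneous polynomials scale: `F_i(t v) = t^i F_i(v)` in the tensor coordinates. [folklore] -/
private theorem aeval_tensorPt_smul_of_isHomogeneous {F : MvPolynomial (ι × ι × ι) ℂ} {i : ℕ}
    (hF : F.IsHomogeneous i) (t : ℂ) (v : ι → ι → ι → ℂ) :
    aeval (tensorPt (t • v)) F = t ^ i * aeval (tensorPt v) F := by
  rw [show tensorPt (t • v) = t • tensorPt v from rfl]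
  simp only [MvPolynomial.aeval_eq_eval]
  exact hF.eval_smul_eq t _

omit [Fintype ι] [DecidableEq ι] in
/-- Coefficient comparison: if `∑_{i < N} t^i c_i = 0` for all `t ∈ ℂ` then every `c_i = 0`.
[folklore] -/
private theorem eq_zero_of_forall_sum_pow_mul_eq_zero {N : ℕ} (c : ℕ → ℂ)
    (h : ∀ t : ℂ, ∑ i ∈ Finset.range N, t ^ i * c i = 0) {i : ℕ} (hi : i < N) : c i = 0 := by
  set P : Polynomial ℂ := ∑ j ∈ Finset.range N, Polynomial.C (c j) * Polynomial.X ^ j with hP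
  have hP0 : P = 0 := by
    apply Polynomial.funext
    intro t
    rw [hP, Polynomial.eval_finsetSum, Polynomial.eval_zero, ← h t]
    refine Finset.sum_congr rfl fun j _ => ?_
    rw [Polynomial.eval_mul, Polynomial.eval_C, Polynomial.eval_pow, Polynomial.eval_X, mul_comm]
  have hc : P.coeff i = c i := by
    rw [hP, Polynomial.finsetSum_coeff]
    simp only [Polynomial.coeff_C_mul_X_pow]
    rw [Finset.sum_eq_single i (fun j _ hj => if_neg (Ne.symm hj)) (fun h' => absurd
      (Finset.mem_range.2 hi) h'), if_pos rfl]
  rw [← hc, hP0, Polynomial.coeff_zero]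

/-- **Homogeneous components of `SL³`-invariants are `SL³`-invariant** (the `SL³`-action commutes with
the scalars: `g·(t w) = t (g·w)`; compare the coefficients of `t` in `F(g·(tw)) = F(tw)`). The tensor
twin of `IsSLInvariantCoord.homogeneousComponent`. [cite: BurgisserIkenmeyer2017, §5 (Def. 5.2)] -/
theorem IsSL3Invariant.homogeneousComponent {F : MvPolynomial (ι × ι × ι) ℂ} (hF : IsSL3Invariant F)
    (i : ℕ) : IsSL3Invariant (MvPolynomial.homogeneousComponent i F) := by
  classical
  intro g₁ g₂ g₃ w
  by_cases hi : F.totalDegree < i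
  · rw [MvPolynomial.homogeneousComponent_eq_zero i F hi, map_zero, map_zero]
  push Not at hi
  set c : ℕ → ℂ := fun j =>
    aeval (tensorPt (actTensor (g₁ : Matrix ι ι ℂ) (g₂ : Matrix ι ι ℂ) (g₃ : Matrix ι ι ℂ) w))
      (MvPolynomial.homogeneousComponent j F) - aeval (tensorPt w) (MvPolynomial.homogeneousComponent j F) with hc
  have hsum : ∀ t : ℂ, ∑ j ∈ Finset.range (F.totalDegree + 1), t ^ j * c j = 0 := by
    intro t
    have h := hF g₁ g₂ g₃ (t • w)
    rw [actTensor_smul_tensor₃] at h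
    conv_lhs at h => rw [← sum_homogeneousComponent F, map_sum]
    conv_rhs at h => rw [← sum_homogeneousComponent F, map_sum]
    simp only [aeval_tensorPt_smul_of_isHomogeneous (homogeneousComponent_isHomogeneous _ F)] at h
    rw [← sub_eq_zero, ← Finset.sum_sub_distrib] at h
    rw [← h]
    refine Finset.sum_congr rfl fun j _ => ?_
    rw [hc, mul_sub]
  have := eq_zero_of_forall_sum_pow_mul_eq_zero c hsum (Nat.lt_succ_of_le hi)
  rwa [hc, sub_eq_zero] at this

/-- **BI 2017, Lemma 6.1 for tensors — all `SL³`-invariants agree at `ζ w` and `w` when `ζ^d = 1` for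
every `d ∈ E(w)`**: a homogeneous component of degree `d` of an invariant is invariant and picks up
the factor `ζ^d` at `ζ w`, and `d ∈ E(w)` unless the component vanishes at `w`. The tensor twin of
`IsSLInvariantCoord.aeval_formCoeff_smul_eq`. [cite: BurgisserIkenmeyer2017, Lemma 6.1] -/
theorem IsSL3Invariant.aeval_tensorPt_smul_eq {F : MvPolynomial (ι × ι × ι) ℂ} (hF : IsSL3Invariant F)
    {w : ι → ι → ι → ℂ} {ζ : ℂ} (hζ : ∀ d ∈ tensorDegreeMonoid w, ζ ^ d = 1) :
    aeval (tensorPt (ζ • w)) F = aeval (tensorPt w) F := by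
  classical
  conv_lhs => rw [← sum_homogeneousComponent F, map_sum]
  conv_rhs => rw [← sum_homogeneousComponent F, map_sum]
  refine Finset.sum_congr rfl fun i _ => ?_
  rw [aeval_tensorPt_smul_of_isHomogeneous (homogeneousComponent_isHomogeneous i F)]
  by_cases h0 : aeval (tensorPt w) (MvPolynomial.homogeneousComponent i F) = 0
  · rw [h0, mul_zero]
  · have hi : i ∈ tensorDegreeMonoid w := by
      refine ⟨_, homogeneousComponent_isHomogeneous i F, hF.homogeneousComponent i, fun hmem => h0 ?_⟩
      have := mem_tensorOrbitVanishingIdeal_iff.1 hmem 1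
      simpa only [Prod.fst_one, Prod.snd_one, Units.val_one, actTensor_one] using this
    rw [hζ i hi, one_mul]

/-- **BI 2017, Lemma 6.3 (core) for tensors**: for `w ≠ 0` of finite stabilizer period `a(w)`, if
`t w ∈ SL_ι(ℂ)³ · w` then `t^{m a(w)} = 1` (`m = |ι|`): `t w = s·w` with `s ∈ SL³` puts
`((t⁻¹ s₁) ⊗ s₂ ⊗ s₃)` in `stab(w)` with `χ = t^{-m}`, and `χ(stab w) = μ_{a(w)}`
(`tensorStabChiImage_eq_rootsOfUnity`). [cite: BurgisserIkenmeyer2017, Lemma 6.3] -/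
theorem pow_eq_one_of_smul_mem_sl3Orbit {w : ι → ι → ι → ℂ} (hw : w ≠ 0)
    (ha : 0 < tensorStabilizerPeriod w) {t : ℂ}
    (ht : t • w ∈ Set.range fun g : Matrix.SpecialLinearGroup ι ℂ × Matrix.SpecialLinearGroup ι ℂ ×
        Matrix.SpecialLinearGroup ι ℂ =>
      actTensor (g.1 : Matrix ι ι ℂ) (g.2.1 : Matrix ι ι ℂ) (g.2.2 : Matrix ι ι ℂ) w) :
    t ^ (Fintype.card ι * tensorStabilizerPeriod w) = 1 := by
  obtain ⟨s, hs⟩ := ht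
  have ht0 : t ≠ 0 := by
    rintro rfl
    rw [zero_smul] at hs
    exact actTensor_sl3_ne_zero hw s hs
  -- the stabilizer element `((t⁻¹ s₁) ⊗ s₂ ⊗ s₃)`
  have hd1 : (t⁻¹ • (s.1 : Matrix ι ι ℂ)).det ≠ 0 := by
    rw [Matrix.det_smul, Matrix.SpecialLinearGroup.det_coe, mul_one]
    exact pow_ne_zero _ (inv_ne_zero ht0)
  have hd2 : (s.2.1 : Matrix ι ι ℂ).det ≠ 0 := by
    rw [Matrix.SpecialLinearGroup.det_coe]; exact one_ne_zero
  have hd3 : (s.2.2 : Matrix ι ι ℂ).det ≠ 0 := by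
    rw [Matrix.SpecialLinearGroup.det_coe]; exact one_ne_zero
  set g : GL ι ℂ × GL ι ℂ × GL ι ℂ :=
    (Matrix.GeneralLinearGroup.mkOfDetNeZero _ hd1, Matrix.GeneralLinearGroup.mkOfDetNeZero _ hd2,
      Matrix.GeneralLinearGroup.mkOfDetNeZero _ hd3) with hg
  have hs' : actTensor (s.1 : Matrix ι ι ℂ) (s.2.1 : Matrix ι ι ℂ) (s.2.2 : Matrix ι ι ℂ) w = t • w :=
    hs
  have hgstab : g ∈ tensorStab w := by
    rw [mem_tensorStab_iff]
    change actTensor (t⁻¹ • (s.1 : Matrix ι ι ℂ)) (s.2.1 : Matrix ι ι ℂ) (s.2.2 : Matrix ι ι ℂ) w = w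
    rw [actTensor_smul_fst₃, hs', smul_smul, inv_mul_cancel₀ ht0, one_smul]
  have hchi : ((tensorChi g : ℂˣ) : ℂ) = (t⁻¹) ^ Fintype.card ι := by
    simp only [hg, tensorChi, Units.val_mul, Matrix.GeneralLinearGroup.val_det_apply,
      Matrix.GeneralLinearGroup.val_mkOfDetNeZero, Matrix.det_smul, Matrix.SpecialLinearGroup.det_coe,
      mul_one]
  have hmem : tensorChi g ∈ tensorStabChiImage w := ⟨g, hgstab, rfl⟩
  rw [tensorStabChiImage_eq_rootsOfUnity w ha] at hmem
  have hroot := (mem_rootsOfUnity' (tensorStabilizerPeriod w) (tensorChi g)).1 hmem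
  rw [hchi, ← pow_mul, inv_pow] at hroot
  exact inv_eq_one.1 hroot

/-- **BI 2017, Thm. 5.3 ("the degree monoid `E(w)` generates the group `m a(w) ℤ`") for a polystable
`w ≠ 0`, MODULO the two outputs of the `SL³`-Reynolds operator**, taken as explicit hypotheses:
Hilbert's nonvanishing `hH` (a positive element of `E(w)`) and invariant separation `hS` of the closed
orbits `SL³·(c w)` and `SL³·w` when they are different (GIT, "since `π` is a GIT quotient, the orbit
closures of `tw` and `w` intersect", Lemma 6.3). The proof is the printed §6.2/§6.4 one, as in the forms
theorem `BI2017_thm_3_4_holds`: `⊆` is the tree's `BI2017_thm_5_3_le`; for `⊇`, `⟨E(w)⟩ = ℓℤ` with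
`ℓ ≠ 0`, a primitive `|ℓ|`-th root of unity `ζ` fixes every invariant (Lemma 6.1,
`IsSL3Invariant.aeval_tensorPt_smul_eq`), so `ζ w ∈ SL³·w` by `hS`, whence `ζ^{m a(w)} = 1`
(Lemma 6.3, `pow_eq_one_of_smul_mem_sl3Orbit`) and `|ℓ| ∣ m a(w)`.
[cite: BurgisserIkenmeyer2017, Thm. 5.3] -/
theorem BI2017_thm_5_3_of_hilbert_of_separation (m : ℕ) (w : Fin m → Fin m → Fin m → ℂ) (hw : w ≠ 0)
    (hps : IsPolystableTensor w) (hH : ∃ d ∈ tensorDegreeMonoid w, 0 < d)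
    (hS : ∀ c : ℂ, c ≠ 0 →
      c • w ∉ (Set.range fun g : Matrix.SpecialLinearGroup (Fin m) ℂ ×
          Matrix.SpecialLinearGroup (Fin m) ℂ × Matrix.SpecialLinearGroup (Fin m) ℂ =>
        actTensor (g.1 : Matrix (Fin m) (Fin m) ℂ) (g.2.1 : Matrix (Fin m) (Fin m) ℂ)
          (g.2.2 : Matrix (Fin m) (Fin m) ℂ) w) →
      ∃ F : MvPolynomial (Fin m × Fin m × Fin m) ℂ, IsSL3Invariant F ∧
        aeval (tensorPt (c • w)) F = 1 ∧ aeval (tensorPt w) F = 0) :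
    AddSubgroup.closure ((fun d : ℕ => (d : ℤ)) '' tensorDegreeMonoid w) =
      AddSubgroup.zmultiples ((m * tensorStabilizerPeriod w : ℕ) : ℤ) := by
  classical
  have hm0 : m ≠ 0 := by
    rintro rfl
    exact hw (funext fun a => Fin.elim0 a)
  have hm : 0 < m := Nat.pos_of_ne_zero hm0
  have ha : 0 < tensorStabilizerPeriod w :=
    Nat.pos_of_ne_zero (BI2017_polystableTensor_period_holds m w hw hps)
  refine le_antisymm (BI2017_thm_5_3_le m hm w ha) ?_
  set H := AddSubgroup.closure ((fun d : ℕ => (d : ℤ)) '' tensorDegreeMonoid w) with hHdef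
  obtain ⟨ℓ, hℓ⟩ := Int.subgroup_cyclic H
  have hHℓ : H = AddSubgroup.zmultiples ℓ := by rw [hℓ, AddSubgroup.zmultiples_eq_closure]
  set n : ℕ := ℓ.natAbs with hn
  -- every `d ∈ E(w)` is a multiple of `n = |ℓ|`
  have hdvd : ∀ d ∈ tensorDegreeMonoid w, n ∣ d := by
    intro d hd
    have hdH : (d : ℤ) ∈ H := AddSubgroup.subset_closure ⟨d, hd, rfl⟩
    rw [hHℓ, Int.mem_zmultiples_iff] at hdH
    exact Int.natCast_dvd_natCast.1 (Int.natAbs_dvd.2 hdH)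
  -- `n ≠ 0`: `E(w)` has a positive element (Hilbert's nonvanishing)
  obtain ⟨d₀, hd₀, hd₀pos⟩ := hH
  have hn0 : n ≠ 0 := by
    intro h
    have h1 := hdvd d₀ hd₀
    rw [h, zero_dvd_iff] at h1
    omega
  -- `ζ`, a primitive `n`-th root of unity, fixes the value of every invariant
  have hζ := Complex.isPrimitiveRoot_exp n hn0
  set ζ : ℂ := Complex.exp (2 * Real.pi * Complex.I / n) with hζdef
  have hζ0 : ζ ≠ 0 := hζ.ne_zero hn0
  have hζpow : ∀ d ∈ tensorDegreeMonoid w, ζ ^ d = 1 := fun d hd =>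
    (hζ.pow_eq_one_iff_dvd d).2 (hdvd d hd)
  -- hence `ζ w ∈ SL³ · w` (otherwise an invariant separates the two closed orbits)
  have hmem : ζ • w ∈ (Set.range fun g : Matrix.SpecialLinearGroup (Fin m) ℂ ×
        Matrix.SpecialLinearGroup (Fin m) ℂ × Matrix.SpecialLinearGroup (Fin m) ℂ =>
      actTensor (g.1 : Matrix (Fin m) (Fin m) ℂ) (g.2.1 : Matrix (Fin m) (Fin m) ℂ)
        (g.2.2 : Matrix (Fin m) (Fin m) ℂ) w) := by
    by_contra hnot
    obtain ⟨F, hFi, hF1, hF0⟩ := hS ζ hζ0 hnot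
    rw [hFi.aeval_tensorPt_smul_eq hζpow, hF0] at hF1
    exact zero_ne_one hF1
  -- Lemma 6.3: `ζ ^ (m a(w)) = 1`, so `n ∣ m a(w)`
  have hb : ζ ^ (m * tensorStabilizerPeriod w) = 1 := by
    have h := pow_eq_one_of_smul_mem_sl3Orbit hw ha hmem
    rwa [Fintype.card_fin] at h
  have hnb : n ∣ m * tensorStabilizerPeriod w := (hζ.pow_eq_one_iff_dvd _).1 hb
  rw [AddSubgroup.zmultiples_le, hHℓ, Int.mem_zmultiples_iff]
  exact Int.natAbs_dvd.1 (Int.natCast_dvd_natCast.2 hnb)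

/-- The same in the shape of the named fact: `BI2017_thm_5_3` follows from tensor Hilbert
nonvanishing and invariant separation of distinct closed orbits `SL³·(c w)`, `SL³·w` (both the
standard outputs of an `SL³`-Reynolds operator; hypotheses stated inline, not as named facts).
[cite: BurgisserIkenmeyer2017, Thm. 5.3] -/
theorem BI2017_thm_5_3_of_hilbert_of_separation'
    (hH : ∀ (m : ℕ) (w : Fin m → Fin m → Fin m → ℂ), w ≠ 0 → IsPolystableTensor w →
      ∃ d ∈ tensorDegreeMonoid w, 0 < d)
    (hS : ∀ (m : ℕ) (w : Fin m → Fin m → Fin m → ℂ), w ≠ 0 → IsPolystableTensor w → ∀ c : ℂ, c ≠ 0 →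
      c • w ∉ (Set.range fun g : Matrix.SpecialLinearGroup (Fin m) ℂ ×
          Matrix.SpecialLinearGroup (Fin m) ℂ × Matrix.SpecialLinearGroup (Fin m) ℂ =>
        actTensor (g.1 : Matrix (Fin m) (Fin m) ℂ) (g.2.1 : Matrix (Fin m) (Fin m) ℂ)
          (g.2.2 : Matrix (Fin m) (Fin m) ℂ) w) →
      ∃ F : MvPolynomial (Fin m × Fin m × Fin m) ℂ, IsSL3Invariant F ∧
        aeval (tensorPt (c • w)) F = 1 ∧ aeval (tensorPt w) F = 0) :
    BI2017_thm_5_3 :=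
  fun m w hw hps => BI2017_thm_5_3_of_hilbert_of_separation m w hw hps (hH m w hw hps) (hS m w hw hps)

/-! ### Lemma 5.1 (3) `⊇` modulo invariant lifting -/

/-- **`m a(w) e ∈ E(w)` for `e ∈ E'(w)`, modulo INVARIANT LIFTING** (the `⊇` half of Lemma 5.1 (3)
"`E(w) = m a(w) E'(w)`"): if the regular extension `F` of `φ_w^e` (which is `SL³`-invariant on `Gw`)
is congruent modulo `I(Gw)` to an `SL³`-invariant polynomial `z`, then the degree-`m a(w) e`
homogeneous component of `z` is a homogeneous `SL³`-invariant with value `χ(g)^{a(w) e}` at `g w`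
(compare coefficients of `t` in `z(t · g w) = t^{m a e} χ(g)^{a e}`, `t ≠ 0`), in particular it does
not vanish on `Gw`. [cite: BurgisserIkenmeyer2017, Lemma 5.1 (3)] -/
theorem mul_mem_tensorDegreeMonoid_of_lift [Nonempty ι] (w : ι → ι → ι → ℂ) {e : ℕ}
    {z : MvPolynomial (ι × ι × ι) ℂ} (hz : IsSL3Invariant z)
    (hzval : ∀ g : GL ι ℂ × GL ι ℂ × GL ι ℂ,
      aeval (tensorPt (actTensor (g.1 : Matrix ι ι ℂ) (g.2.1 : Matrix ι ι ℂ) (g.2.2 : Matrix ι ι ℂ) w))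
        z = ((tensorChi g : ℂˣ) : ℂ) ^ (tensorStabilizerPeriod w * e)) :
    Fintype.card ι * tensorStabilizerPeriod w * e ∈ tensorDegreeMonoid w := by
  classical
  set d := Fintype.card ι * tensorStabilizerPeriod w * e with hd
  set Z := MvPolynomial.homogeneousComponent d z with hZ
  -- `Z(g w) = χ(g)^{a e}` for every `g`
  have hZval : ∀ g : GL ι ℂ × GL ι ℂ × GL ι ℂ,
      aeval (tensorPt (actTensor (g.1 : Matrix ι ι ℂ) (g.2.1 : Matrix ι ι ℂ) (g.2.2 : Matrix ι ι ℂ) w))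
        Z = ((tensorChi g : ℂˣ) : ℂ) ^ (tensorStabilizerPeriod w * e) := by
    intro g
    set v := actTensor (g.1 : Matrix ι ι ℂ) (g.2.1 : Matrix ι ι ℂ) (g.2.2 : Matrix ι ι ℂ) w with hv
    set χ : ℂ := ((tensorChi g : ℂˣ) : ℂ) ^ (tensorStabilizerPeriod w * e) with hχ
    set N := z.totalDegree + 1 with hN
    -- `z(t v) = t^d χ` for `t ≠ 0` (`t v = ((t g₁) ⊗ g₂ ⊗ g₃) w`)
    have hscal : ∀ t : ℂ, t ≠ 0 → aeval (tensorPt (t • v)) z = t ^ d * χ := by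
      intro t ht
      have hdet : (t • (g.1 : Matrix ι ι ℂ)).det ≠ 0 := by
        rw [Matrix.det_smul, ← Matrix.GeneralLinearGroup.val_det_apply]
        exact mul_ne_zero (pow_ne_zero _ ht) (Units.ne_zero _)
      set g' : GL ι ℂ × GL ι ℂ × GL ι ℂ :=
        (Matrix.GeneralLinearGroup.mkOfDetNeZero _ hdet, g.2.1, g.2.2) with hg'
      have hv' : t • v = actTensor (g'.1 : Matrix ι ι ℂ) (g'.2.1 : Matrix ι ι ℂ)
          (g'.2.2 : Matrix ι ι ℂ) w := by
        simp only [hg', Matrix.GeneralLinearGroup.val_mkOfDetNeZero, hv]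
        rw [actTensor_smul_fst₃]
      have hχ' : ((tensorChi g' : ℂˣ) : ℂ) = t ^ Fintype.card ι * ((tensorChi g : ℂˣ) : ℂ) := by
        simp only [hg', tensorChi, Units.val_mul, Matrix.GeneralLinearGroup.val_det_apply,
          Matrix.GeneralLinearGroup.val_mkOfDetNeZero, Matrix.det_smul]
        ring
      rw [hv', hzval g', hχ', mul_pow, hχ, ← pow_mul, hd, mul_assoc]
    -- the polynomial `∑ t^i z_i(v) - χ t^d` vanishes on `ℂ ∖ {0}`
    set P : Polynomial ℂ := (∑ i ∈ Finset.range N,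
        Polynomial.C (aeval (tensorPt v) (MvPolynomial.homogeneousComponent i z)) * Polynomial.X ^ i) -
      Polynomial.C χ * Polynomial.X ^ d with hP
    have hPeval : ∀ t : ℂ, t ≠ 0 → P.eval t = 0 := by
      intro t ht
      have hsum : aeval (tensorPt (t • v)) z =
          ∑ i ∈ Finset.range N, t ^ i * aeval (tensorPt v) (MvPolynomial.homogeneousComponent i z) := by
        conv_lhs => rw [← sum_homogeneousComponent z, map_sum]
        refine Finset.sum_congr rfl fun i _ => ?_
        exact aeval_tensorPt_smul_of_isHomogeneous (homogeneousComponent_isHomogeneous i z) t v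
      rw [hP, Polynomial.eval_sub, Polynomial.eval_finsetSum, Polynomial.eval_mul, Polynomial.eval_C,
        Polynomial.eval_pow, Polynomial.eval_X, sub_eq_zero]
      have : ∑ i ∈ Finset.range N, Polynomial.eval t (Polynomial.C (aeval (tensorPt v)
            (MvPolynomial.homogeneousComponent i z)) * Polynomial.X ^ i) =
          ∑ i ∈ Finset.range N, t ^ i * aeval (tensorPt v) (MvPolynomial.homogeneousComponent i z) := by
        refine Finset.sum_congr rfl fun i _ => ?_
        rw [Polynomial.eval_mul, Polynomial.eval_C, Polynomial.eval_pow, Polynomial.eval_X, mul_comm]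
      rw [this, ← hsum, hscal t ht, mul_comm]
    have hP0 : P = 0 := by
      apply Polynomial.eq_zero_of_infinite_isRoot
      refine Set.Infinite.mono (s := ({0}ᶜ : Set ℂ)) (fun t ht => ?_) (Set.finite_singleton 0).infinite_compl
      exact hPeval t ht
    -- read off the coefficient of `t^d`
    have hcoeff : P.coeff d = (if d < N then aeval (tensorPt v) Z else 0) - χ := by
      rw [hP, Polynomial.coeff_sub, Polynomial.finsetSum_coeff, Polynomial.coeff_C_mul_X_pow, if_pos rfl]
      simp only [Polynomial.coeff_C_mul_X_pow]
      congr 1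
      split_ifs with hlt
      · rw [Finset.sum_eq_single d (fun j _ hj => if_neg (Ne.symm hj))
          (fun h' => absurd (Finset.mem_range.2 hlt) h'), if_pos rfl, hZ]
      · refine Finset.sum_eq_zero fun j hj => ?_
        rw [if_neg]
        rintro rfl
        exact hlt (Finset.mem_range.1 hj)
    rw [hP0, Polynomial.coeff_zero] at hcoeff
    have hχ0 : χ ≠ 0 := pow_ne_zero _ (Units.ne_zero _)
    split_ifs at hcoeff with hlt
    · exact (sub_eq_zero.1 hcoeff.symm)
    · exact absurd (sub_eq_zero.1 hcoeff.symm).symm hχ0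
  refine ⟨Z, homogeneousComponent_isHomogeneous d z, hz.homogeneousComponent d, fun hI => ?_⟩
  have h1 := mem_tensorOrbitVanishingIdeal_iff.1 hI 1
  rw [hZval 1] at h1
  exact pow_ne_zero _ (Units.ne_zero _) h1

/-- **BI 2017, Lemma 5.1 (3) ("`E(w) = m a(w) E'(w)`, hence `e(w) = m a(w) e'(w)`"), REDUCED to
INVARIANT LIFTING from the orbit closure** — the one `SL³`-Reynolds consequence its `⊇` half uses
(BI L1147 / Lemma 3.2 (3) via the algebraic Peter–Weyl theorem): every polynomial which is
`SL³`-invariant on `Gw` is congruent modulo `I(Gw)` to an `SL³`-invariant polynomial (hypothesis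
stated inline, not as a named fact). `⊆` is the tree's `BI2017_lem_5_1_3_subset`; `a(w) ≠ 0` is
`BI2017_polystableTensor_period_holds`. [cite: BurgisserIkenmeyer2017, Lemma 5.1 (3)] -/
theorem BI2017_lem_5_1_3_of_invariantLift
    (hR : ∀ (m : ℕ) (w : Fin m → Fin m → Fin m → ℂ), w ≠ 0 → IsPolystableTensor w →
      ∀ F : MvPolynomial (Fin m × Fin m × Fin m) ℂ,
        (∀ (s : Matrix.SpecialLinearGroup (Fin m) ℂ × Matrix.SpecialLinearGroup (Fin m) ℂ ×
            Matrix.SpecialLinearGroup (Fin m) ℂ) (v : Fin m → Fin m → Fin m → ℂ), v ∈ tensorGLOrbit w →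
          aeval (tensorPt (actTensor (s.1 : Matrix (Fin m) (Fin m) ℂ) (s.2.1 : Matrix (Fin m) (Fin m) ℂ)
            (s.2.2 : Matrix (Fin m) (Fin m) ℂ) v)) F = aeval (tensorPt v) F) →
        ∃ z : MvPolynomial (Fin m × Fin m × Fin m) ℂ, IsSL3Invariant z ∧
          z - F ∈ tensorOrbitVanishingIdeal w) :
    BI2017_lem_5_1_3 := by
  intro m w hw hps
  classical
  have hm0 : m ≠ 0 := by
    rintro rfl
    exact hw (funext fun a => Fin.elim0 a)
  have hm : 0 < m := Nat.pos_of_ne_zero hm0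
  haveI : Nonempty (Fin m) := ⟨⟨0, hm⟩⟩
  have ha0 : tensorStabilizerPeriod w ≠ 0 := BI2017_polystableTensor_period_holds m w hw hps
  have ha : 0 < tensorStabilizerPeriod w := Nat.pos_of_ne_zero ha0
  set a := tensorStabilizerPeriod w with hadef
  set b := m * tensorStabilizerPeriod w with hbdef
  have hb : 0 < b := Nat.mul_pos hm ha
  -- `⊇`: `m a e ∈ E(w)` for `e ∈ E'(w)`
  have hsup : ∀ e ∈ tensorExponentMonoid w, b * e ∈ tensorDegreeMonoid w := by
    intro e he
    obtain ⟨F, hF⟩ := he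
    -- `F` is `SL³`-invariant on `Gw`
    have horb : ∀ (s : Matrix.SpecialLinearGroup (Fin m) ℂ × Matrix.SpecialLinearGroup (Fin m) ℂ ×
        Matrix.SpecialLinearGroup (Fin m) ℂ) (v : Fin m → Fin m → Fin m → ℂ), v ∈ tensorGLOrbit w →
        aeval (tensorPt (actTensor (s.1 : Matrix (Fin m) (Fin m) ℂ) (s.2.1 : Matrix (Fin m) (Fin m) ℂ)
          (s.2.2 : Matrix (Fin m) (Fin m) ℂ) v)) F = aeval (tensorPt v) F := by
      rintro s v ⟨g, rfl⟩
      have hd1 : ((s.1 : Matrix (Fin m) (Fin m) ℂ) * (g.1 : Matrix (Fin m) (Fin m) ℂ)).det ≠ 0 := by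
        rw [Matrix.det_mul, Matrix.SpecialLinearGroup.det_coe, one_mul,
          ← Matrix.GeneralLinearGroup.val_det_apply]
        exact Units.ne_zero _
      have hd2 : ((s.2.1 : Matrix (Fin m) (Fin m) ℂ) * (g.2.1 : Matrix (Fin m) (Fin m) ℂ)).det ≠ 0 := by
        rw [Matrix.det_mul, Matrix.SpecialLinearGroup.det_coe, one_mul,
          ← Matrix.GeneralLinearGroup.val_det_apply]
        exact Units.ne_zero _
      have hd3 : ((s.2.2 : Matrix (Fin m) (Fin m) ℂ) * (g.2.2 : Matrix (Fin m) (Fin m) ℂ)).det ≠ 0 := by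
        rw [Matrix.det_mul, Matrix.SpecialLinearGroup.det_coe, one_mul,
          ← Matrix.GeneralLinearGroup.val_det_apply]
        exact Units.ne_zero _
      set g' : GL (Fin m) ℂ × GL (Fin m) ℂ × GL (Fin m) ℂ :=
        (Matrix.GeneralLinearGroup.mkOfDetNeZero _ hd1, Matrix.GeneralLinearGroup.mkOfDetNeZero _ hd2,
          Matrix.GeneralLinearGroup.mkOfDetNeZero _ hd3) with hg'
      have hχ : tensorChi g' = tensorChi g := by
        ext
        simp only [hg', tensorChi, Units.val_mul, Matrix.GeneralLinearGroup.val_det_apply,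
          Matrix.GeneralLinearGroup.val_mkOfDetNeZero, Matrix.det_mul, Matrix.SpecialLinearGroup.det_coe,
          one_mul]
      rw [actTensor_actTensor, hF g]
      have h' := hF g'
      simp only [hg', Matrix.GeneralLinearGroup.val_mkOfDetNeZero] at h'
      rw [h']
      simp only [← hg', hχ]
    obtain ⟨z, hz, hzF⟩ := hR m w hw hps F horb
    have hzval : ∀ g : GL (Fin m) ℂ × GL (Fin m) ℂ × GL (Fin m) ℂ,
        aeval (tensorPt (actTensor (g.1 : Matrix (Fin m) (Fin m) ℂ) (g.2.1 : Matrix (Fin m) (Fin m) ℂ)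
          (g.2.2 : Matrix (Fin m) (Fin m) ℂ) w)) z = ((tensorChi g : ℂˣ) : ℂ) ^ (a * e) := by
      intro g
      have h0 := mem_tensorOrbitVanishingIdeal_iff.1 hzF g
      rw [map_sub, sub_eq_zero] at h0
      rw [h0, hF g]
    have h := mul_mem_tensorDegreeMonoid_of_lift w hz hzval
    rwa [Fintype.card_fin] at h
  have hEq : tensorDegreeMonoid w = (fun e => b * e) '' tensorExponentMonoid w := by
    refine Set.Subset.antisymm (BI2017_lem_5_1_3_subset m hm w ha) ?_
    rintro _ ⟨e, he, rfl⟩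
    exact hsup e he
  refine ⟨hEq, ?_⟩
  -- minimal positive elements correspond under `d = b e`
  change sInf {d | d ∈ tensorDegreeMonoid w ∧ 0 < d} = b * sInf {e | e ∈ tensorExponentMonoid w ∧ 0 < e}
  set S : Set ℕ := {d | d ∈ tensorDegreeMonoid w ∧ 0 < d} with hS
  set S' : Set ℕ := {e | e ∈ tensorExponentMonoid w ∧ 0 < e} with hS'
  by_cases hne : S'.Nonempty
  · obtain ⟨he₀, he₀pos⟩ := Nat.sInf_mem hne
    have hSne : S.Nonempty := ⟨b * sInf S', hsup _ he₀, Nat.mul_pos hb he₀pos⟩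
    refine le_antisymm (Nat.sInf_le ⟨hsup _ he₀, Nat.mul_pos hb he₀pos⟩) ?_
    obtain ⟨hd₁, hd₁pos⟩ := Nat.sInf_mem hSne
    rw [hEq] at hd₁
    obtain ⟨e₁, he₁, he₁eq⟩ := hd₁
    have he₁eq' : b * e₁ = sInf S := he₁eq
    have he₁pos : 0 < e₁ := by
      rcases Nat.eq_zero_or_pos e₁ with h | h
      · rw [← he₁eq', h, mul_zero] at hd₁pos; exact absurd hd₁pos (lt_irrefl 0)
      · exact h
    calc b * sInf S' ≤ b * e₁ := Nat.mul_le_mul_left _ (Nat.sInf_le ⟨he₁, he₁pos⟩)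
      _ = sInf S := he₁eq'
  · rw [Set.not_nonempty_iff_eq_empty] at hne
    have hSe : S = ∅ := by
      refine Set.eq_empty_iff_forall_notMem.2 fun d hd => ?_
      obtain ⟨hdE, hdpos⟩ := hd
      rw [hEq] at hdE
      obtain ⟨e, he, rfl⟩ := hdE
      have hdpos' : 0 < b * e := hdpos
      have hepos : 0 < e := by
        rcases Nat.eq_zero_or_pos e with h | h
        · rw [h, mul_zero] at hdpos'; exact absurd hdpos' (lt_irrefl 0)
        · exact h
      have : e ∈ S' := ⟨he, hepos⟩
      rw [hne] at this
      exact this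
    rw [hSe, hne, Nat.sInf_empty, mul_zero]

end GroupLemmas

end Literature.Computability.AlgebraicComplexity

end
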